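import Mathlib
import HarnessLib
import Summits.Langlands.Langlands.Theses.ParityBlindBianchi
import Literature.RepresentationTheory.CompactGroups.ReproducingKernelKOneAverage
noncomputable section
open scoped BigOperators Topology Classical Matrix NumberField MatrixGroups ComplexConjugate
open Literature.NumberTheory.Automorphic Literature.NumberTheory.GaloisRepresentations
  IsDedekindDomain NumberField Filter MeasureTheory
open Literature.NumberTheory.Automorphic.AdelicGroupData
open NumberField.mixedEmbedding MeasureTheory.Measure
set_option linter.dupNamespace false
namespace Summit.Langlands.Langlands.Theorems.QuadraticBaseChangeGL2

/-!
# The reproducing kernel evaluates `K₁`-averages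
# (registered stub `stub_reproducingKernel_kOneAverage` of the line `Sketch`, input R1)

The abstract harmonic-analysis input of the Humphries–Jo route to the archimedean
`GL₂ × GL₂` Rankin–Selberg test-vector identity (consumed, as a hypothesis, by
`stub_kAverageGammaGL2_of_reproducingKernel`): for `G` compact second countable with Haar measure
`μ`, `K₁ ≤ G` closed with Haar measure `μ₁`, and `Pol` a finite-dimensional space of continuous
left-`K₁`-invariant functions `G → ℂ`, there is `Z ∈ Pol` with
`∫_G conj Z · φ dμ = ∫_{K₁} φ dμ₁` for every continuous `φ` whose left `K₁`-average lies in
`Pol`.  PROVED in `Literature/RepresentationTheory/CompactGroups/ReproducingKernelKOneAverage.lean`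
(`Literature.RepresentationTheory.CompactGroups.exists_reproducingKernel_kOneAverage`: the
`L²(μ)` pairing is a positive-definite inner product on `Pol` since a Haar measure charges every
non-empty open set, so evaluation at `1` has a Riesz representer `Z₀ ∈ Pol`; then Fubini on
`G × K₁`, left `K₁`-invariance of `Z₀` and left invariance of `μ` give `Z = μ₁(K₁) · Z₀`); this
file is the one-line application at universe level `0`.
-/

/-- **The reproducing kernel of a finite-dimensional space of left-`K₁`-invariant continuous
functions on a compact group evaluates `K₁`-averages** (registered stub
`stub_reproducingKernel_kOneAverage`, R1 of the Humphries–Jo route).  For `G` compact second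
countable with Haar measure `μ`, `K₁ ≤ G` closed with Haar measure `μ₁`, `Pol` a finite-dimensional
space of continuous left-`K₁`-invariant functions: there is `Z ∈ Pol` with
`∫_G conj Z · φ dμ = ∫_{K₁} φ dμ₁` for every continuous `φ` whose left `K₁`-average
`k ↦ ∫_{K₁} φ (k₁ k) dμ₁(k₁)` lies in `Pol` (`Z = μ₁(K₁) ·` the Riesz representer of `Q ↦ Q 1` for
the `L²(μ)` inner product on `Pol`), by
`Literature.RepresentationTheory.CompactGroups.exists_reproducingKernel_kOneAverage`.
[folklore] -/
theorem stub_reproducingKernel_kOneAverage : ∀ {G : Type} [Group G] [TopologicalSpace G]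
    [IsTopologicalGroup G] [CompactSpace G] [SecondCountableTopology G] [MeasurableSpace G]
    [BorelSpace G] (μ : Measure G) [IsHaarMeasure μ] (K₁ : Subgroup G)
    (hK₁ : IsClosed (K₁ : Set G)) (μ₁ : Measure ↥K₁) [IsHaarMeasure μ₁]
    (Pol : Submodule ℂ (G → ℂ)) [FiniteDimensional ℂ Pol]
    (hcont : ∀ Q ∈ Pol, Continuous Q) (hleft : ∀ Q ∈ Pol, ∀ k₁ ∈ K₁, ∀ k : G, Q (k₁ * k) = Q k),
      ∃ Z ∈ Pol, ∀ φ : G → ℂ, Continuous φ → (fun k => ∫ k₁ : ↥K₁, φ ((k₁ : G) * k) ∂μ₁) ∈ Pol →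
      ∫ k, conj (Z k) * φ k ∂μ = ∫ k₁ : ↥K₁, φ (k₁ : G) ∂μ₁ := by
  intro G _ _ _ _ _ _ _ μ _ K₁ hK₁ μ₁ _ Pol _ hcont hleft
  exact Literature.RepresentationTheory.CompactGroups.exists_reproducingKernel_kOneAverage μ K₁
    hK₁ μ₁ Pol hcont hleft

end Summit.Langlands.Langlands.Theorems.QuadraticBaseChangeGL2

end
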